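/-
Origin: expansion seat `literature-prover-pub-hodgecm-cf-gaoullmo-g4-0`, handover #1 2026-08-18T06:24:53Z doc-only (`HOME/pub-hodgecm-cf-gaoullmo-g4/lean/CfGU4/GaoUllmo.lean`, md5 23b90bf6, 519 lines);
landed by the gen-6 packager in gate run 24 REPLACES the earlier landed copy of `HodgeCM/Literature/GaoUllmo.lean` (verbatim).
-/
/-
Copyright: pub-hodgecm formalisation cell (harness21, 2026). New file (not vendored).
Origin: HOME/pub-hodgecm-cf-gaoullmo/GaoUllmo.lean (unit pub-hodgecm-cf-gaoullmo, session
literature-prover-pub-hodgecm-cf-gaoullmo-0), CITED-FACT SEAT (4); suggested target `HodgeCM/Literature/GaoUllmo.lean`.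
-/
import Mathlib.LinearAlgebra.ExteriorPower.Basis
import Mathlib.NumberTheory.NumberField.CMField
import Mathlib.FieldTheory.IntermediateField.Adjoin.Basic
import Mathlib.Algebra.Algebra.Rat
import Mathlib.Analysis.Complex.Basic

/-!
# Gao–Ullmo, *Hodge cycles and quadratic relations between holomorphic periods on CM abelian varieties* — cited statements, typed verbatim

Source (PUBLISHED, refereed, open access CC-BY): Z. Gao, E. Ullmo, *Hodge cycles and quadratic relations between
holomorphic periods on CM abelian varieties*, J. Inst. Math. Jussieu **25** (2025), no. 1, 215–249,
doi:10.1017/S1474748025101291 (received 20 Nov 2024, accepted 1 Sept 2025) = arXiv:2411.12249.  Held texts: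
`corpus:paper:galaxy-pdf-4667137180` (the published text, held as 42 chunks `p0001 … p0042` of 3000 characters — NOT
pages; the article's own table of contents, chunk p0001, places §2 at p. 6, §3 at p. 10, §4 at p. 13, §5 at p. 15, §6 at
p. 17 of the ARTICLE pagination; journal pagination is 215–249) and `corpus:paper:arxiv-2411.12249` (arXiv TeX).  Every
docstring below quotes the published text and gives TWO locators: "art. p. N" = the article page inferred from that
table of contents (exact only to the resolution of the section boundaries), and "chunk p00MM Lk" = the held-text chunk and
line actually read (the verifiable locator; referee 2 calls these chunks "journal PDF p.").  Theorem / equation numbers are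
those of the published version (identical in the arXiv version).  Bib key: `GaoUllmo2025`
(`lit cite doi:10.1017/s1474748025101291`).

This file is a CITED-FACT file in the sense of the cell's rule "every hypothesis is either kernel-proved in this
package or a verbatim quotation of a PUBLISHED theorem with page reference": it contains

* the paper's own MODEL of the cohomology of a CM abelian variety (§2.1, §2.3 eq. (2.2), §3.1 first paragraph) as
  real DEFINITIONS — `Emb E = Hom(E, ℂ)`, `galoisClosure E = E^c ⊂ ℂ`, `galAct` (the action of `G = Gal(E^c/ℚ)` on
  `Hom(E, ℂ)`), `VC E = ℂ^S`, `ratVec` (`H¹(A, ℚ) = E`, a free `E`-module of rank one, inside `H¹(A, ℂ) = ℂ^S`),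
  `Hr E r = ⋀^r ℂ^S`, `wedge P = [P]`, `ratStr` (`H^r(A, ℚ) = ⋀^r_ℚ H¹(A, ℚ)`), `Hpp` (`H^{p,p}`), `Bp` (`B^p(A)`),
  `SatisfiesEq32` (condition (3.2));
* the paper's THEOREM 3.1 "(Pohlmann)" as two named propositions `Theorem31` (the basis / span statement) and
  `Theorem31_finrank` (its "In particular" clause) — named `Prop`s, stated only in THIS file and KERNEL-PROVED downstream in
  `HodgeCM/Literature/GaoUllmoTheorem31.lean` (`GaoUllmo.Theorem31_holds`, gate run 20; `GaoUllmo.Theorem31_finrank_holds`, run 21);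
* the paper's PROPOSITION 4.5 (the formula for `rec^*`, as a DEFINITION `recStar`) and PROPOSITION 5.1 (the kernel of
  `rec^*` is generated by the quadrilateral relations) as the named proposition `Proposition51` — this one is pure
  combinatorics and is KERNEL-PROVED below (`Proposition51_holds`, following the paper's Lemma 5.3 / Lemma 5.5).

What is deliberately NOT here: any statement about the cell's geometric universe `HodgeCM.Universe` (the dictionary
from this model to `U.Coh (U.cmProd F Θ)`, `U.hodge`, `U.IsWeightVector` is NOT in Gao–Ullmo; it is the business of
model facts / provers — see `HOME/CITED-FACTS.md` rows GU-S1, GU-S2 and `HOME/GAPS.md`), and any 2001-programme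
statement ([QW8] Lemma 2.2, rfwf (GEN)), which are not citable.

Design notes.  (1) `E` is any commutative `ℚ`-algebra; "CM algebra" is the hypothesis `IsCMAlgebra E` (a finite
product of CM fields, verbatim §2.1), carried by the theorem, not by the definitions.  (2) The theorem is insensitive
to the choice of generator of each eigenline `ℂφ` and to the ordering of `S`; we take the standard basis of `ℂ^S` and
quantify over all linear orders of `S` satisfying the paper's convention `φ ≤ φ'` for `φ ∈ Φ`, `φ' ∈ Φ̄`.  (3) The
rational structure: §2.3 makes `V = H¹(A, ℚ)` a free `E`-module of rank one whose complexification is the sum of the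
eigenlines `V_{ℂ,φ}`, `φ ∈ Hom(E, ℂ)` (eq. (2.2)); with `V = E` this is the map `a ↦ (φ(a))_φ`, `E → ℂ^S` (`ratVec`),
and `H^r(A, ℚ) = ⋀^r_ℚ V ⊂ ⋀^r_ℂ ℂ^S` is the `ℚ`-span of the wedges of rational vectors (`ratStr`).  (4) `B^p(A) ⊗ ℂ` is
read as the `ℂ`-span of `B^p(A)` inside `H^{2p}(A, ℂ)`, as the paper does ("`B^p(A) ⊆ B^p(A) ⊗ ℂ`",
"`[P] ∈ B^p(A) ⊗ ℂ`", proof of Thm 3.1).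
-/

noncomputable section

open Module

attribute [local instance] Classical.propDecidable

namespace HodgeCM
namespace GaoUllmo

/-! ### §2.1 CM algebras, complex embeddings, CM types, the Galois closure `E^c` -/

section CMPair

variable (E : Type) [CommRing E] [Algebra ℚ E]

/-- `Hom(E, ℂ)`: the `ℚ`-algebra homomorphisms `E → ℂ` (§2.1: "the Galois group `G := Gal(E^c/ℚ)` acts on
`Hom(E, ℂ) = Φ ⊔ Φ̄`"; §3.1: "`S = Φ ⊔ Φ̄`"). -/
abbrev Emb : Type := E →ₐ[ℚ] ℂ

/-- **CM algebra** (§2.1, art. p. 6, chunk p0007 L1, verbatim): "A number field `E` is called a CM field if it is an imaginary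
quadratic extension of a totally real number field. A CM algebra is a finite product of CM fields."  Mathlib's
`NumberField.IsCMField K` is "`K` is a totally complex quadratic extension of its maximal real subfield", which is the
same notion. -/
def IsCMAlgebra : Prop :=
  ∃ (ι : Type) (_ : Fintype ι) (K : ι → Type) (_ : ∀ i, Field (K i)) (_ : ∀ i, NumberField (K i)),
    (∀ i, NumberField.IsCMField (K i)) ∧ Nonempty (E ≃ₐ[ℚ] ((i : ι) → K i))

/-- Complex conjugation as a `ℚ`-algebra endomorphism of `ℂ`. -/
def conjC : ℂ →ₐ[ℚ] ℂ := (starRingEnd ℂ).toRatAlgHom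

/-- (Ported verbatim from the HodgeCMPerL package; no docstring in the source.) -/
@[simp] theorem conjC_apply (z : ℂ) : conjC z = starRingEnd ℂ z := rfl

variable {E}

/-- The complex conjugate `φ̄ = c ∘ φ` of an embedding (§2.1: "`Φ̄ = {φ̄₁, …, φ̄_g}` is the complex conjugate of `Φ`"). -/
def conjEmb (φ : Emb E) : Emb E := conjC.comp φ

/-- (Ported verbatim from the HodgeCMPerL package; no docstring in the source.) -/
@[simp] theorem conjEmb_apply (φ : Emb E) (a : E) : conjEmb φ a = starRingEnd ℂ (φ a) := rfl

/-- (Ported verbatim from the HodgeCMPerL package; no docstring in the source.) -/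
@[simp] theorem conjEmb_conjEmb (φ : Emb E) : conjEmb (conjEmb φ) = φ := by
  ext a; simp

variable (E)

/-- **CM type** (§2.1, art. p. 6, chunk p0007 L1–L3, verbatim): "A CM type on a CM algebra `E` is a subset
`Φ = {φ₁, …, φ_g} ⊆ Hom(E, ℂ)` such that `Hom(E, ℂ) = Φ ⊔ Φ̄` (where `Φ̄ = {φ̄₁, …, φ̄_g}` is the complex conjugate
of `Φ`)."  The disjoint-union condition is recorded as: `φ ∈ Φ ↔ φ̄ ∉ Φ` for every `φ` (for the involution
`φ ↦ φ̄` this is equivalent to `Hom(E, ℂ) = Φ ⊔ Φ̄`; same shape as the vendored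
`Literature.AlgebraicGeometry.Motives.CMType`).  "A CM pair is a pair `(E, Φ)` consisting of a CM algebra `E` and a
CM type `Φ`." -/
structure CMTypeOn where
  /-- the set `Φ ⊆ Hom(E, ℂ)` -/
  Φ : Finset (Emb E)
  /-- `Hom(E, ℂ) = Φ ⊔ Φ̄` -/
  mem_iff : ∀ φ : Emb E, φ ∈ Φ ↔ conjEmb φ ∉ Φ

variable {E}

/-- `Φ̄`, the complex conjugate of `Φ` (a `Finset`). -/
def CMTypeOn.bar (Φ : CMTypeOn E) : Finset (Emb E) := Φ.Φ.image conjEmb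

/-- (Ported verbatim from the HodgeCMPerL package; no docstring in the source.) -/
theorem CMTypeOn.mem_bar_iff (Φ : CMTypeOn E) (φ : Emb E) : φ ∈ Φ.bar ↔ φ ∉ Φ.Φ := by
  classical
  unfold CMTypeOn.bar
  constructor
  · rintro h
    obtain ⟨ψ, hψ, rfl⟩ := Finset.mem_image.mp h
    exact (Φ.mem_iff ψ).mp hψ
  · intro h
    refine Finset.mem_image.mpr ⟨conjEmb φ, ?_, conjEmb_conjEmb φ⟩
    rw [Φ.mem_iff, conjEmb_conjEmb]
    exact h

variable (E)

/-- **The Galois closure `E^c ⊂ ℂ`** (§2.1, art. p. 6–7, chunk p0007 L7, verbatim): "the Galois closure `E^c` of a CM algebra `E`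
is defined as follows: `E = E₁^{n₁} × ⋯ × E_m^{n_m}` with each `E_j` a CM field, and `E^c` is defined to be the
composite of the Galois closures of `E₁, …, E_m` in `ℚ̄`" (`ℚ̄` = the algebraic closure of `ℚ` in `ℂ`, §1).  The Galois
closure of `E_j` in `ℚ̄` is the composite of the images of all complex embeddings of `E_j`, and every
`φ ∈ Hom(E, ℂ)` factors through a projection `E → E_j`, so `E^c` is the subfield of `ℂ` generated by
`⋃_{φ ∈ Hom(E,ℂ)} φ(E)` — which is the definition taken here (meaningful for any `ℚ`-algebra `E`). -/
def galoisClosure : IntermediateField ℚ ℂ :=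
  IntermediateField.adjoin ℚ (⋃ φ : Emb E, Set.range φ)

/-- (Ported verbatim from the HodgeCMPerL package; no docstring in the source.) -/
theorem range_subset_galoisClosure (φ : Emb E) : Set.range φ ⊆ (galoisClosure E : Set ℂ) := fun _ hz =>
  IntermediateField.subset_adjoin ℚ _ (Set.mem_iUnion.mpr ⟨φ, hz⟩)

/-- An embedding `φ : E → ℂ` corestricted to `E^c` (`Hom(E, ℂ) = Hom(E, E^c)`). -/
def corestrict (φ : Emb E) : E →ₐ[ℚ] galoisClosure E :=
  AlgHom.codRestrict φ (galoisClosure E).toSubalgebra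
    (fun a => range_subset_galoisClosure E φ (Set.mem_range_self a))

/-- (Ported verbatim from the HodgeCMPerL package; no docstring in the source.) -/
@[simp] theorem coe_corestrict_apply (φ : Emb E) (a : E) : (corestrict E φ a : ℂ) = φ a := rfl

/-- **The action of `G = Gal(E^c/ℚ)` on `Hom(E, ℂ)`** (§2.1, art. p. 7, chunk p0007 L7, verbatim): "Then the Galois group
`G := Gal(E^c/ℚ)` acts on `Hom(E, ℂ) = Φ ⊔ Φ̄`" — by post-composition, `σ · φ = σ ∘ φ`, reading `φ` as a map into
`E^c`. -/
def galAct (σ : galoisClosure E ≃ₐ[ℚ] galoisClosure E) (φ : Emb E) : Emb E :=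
  ((galoisClosure E).val.comp (σ : galoisClosure E →ₐ[ℚ] galoisClosure E)).comp (corestrict E φ)

/-- (Ported verbatim from the HodgeCMPerL package; no docstring in the source.) -/
@[simp] theorem galAct_apply (σ : galoisClosure E ≃ₐ[ℚ] galoisClosure E) (φ : Emb E) (a : E) :
    galAct E σ φ a = (σ (corestrict E φ a) : ℂ) := rfl

/-- The induced action of `G` on `𝒫(S)` (§3.1: "Finally, the Galois group `G = Gal(E^c/ℚ)` operates on `𝒫(S)`"). -/
def galActSet (σ : galoisClosure E ≃ₐ[ℚ] galoisClosure E) (P : Finset (Emb E)) : Finset (Emb E) :=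
  P.image (galAct E σ)

end CMPair

/-! ### §2.3 and §3.1: the cohomology of `A` — `H¹(A, ℂ) = ℂ^S`, `H^r(A, ℂ) = ⋀^r ℂ^S`, `[P]`, `H^{p,q}`, `B^p(A)` -/

section Model

variable (E : Type) [CommRing E] [Algebra ℚ E]

/-- `ℂ^S`, `S = Hom(E, ℂ)` (§3.1: "We have an isomorphism `H^r(A, ℂ) = ⋀^r ℂ^S`"; for `r = 1` this is §2.3 eq. (2.2),
`V_ℂ = ⊕_{φ ∈ Φ} V_{ℂ,φ} ⊕ ⊕_{φ ∈ Φ} V_{ℂ,φ̄}`, the decomposition of `V_ℂ = H¹(A, ℂ)` into the eigenlines of `E^×`,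
"`E^×` can be identified with the diagonal torus of `GL(V_ℂ)`"). -/
abbrev VC : Type := Emb E → ℂ

/-- **The rational structure on `H¹`** (§2.3, art. p. 8–9, chunk p0008 L5–L13): `V = H¹(A, ℚ)` is a `ℚ`-vector space of dimension
`2g` on which `E` acts, "the action of `E` on `V` makes `V` into a one dimensional `E`-vector space" (simple case) and
in general `X^*(E^×) = ⊕_φ ℤφ ⊕ ⊕_φ ℤφ̄` with `V_ℂ` the sum of the corresponding eigenspaces (eq. (2.2)); for `A`
associated with `(E, Φ)`, i.e. isogenous to `ℂ^g/Φ(𝓞_E)` (§2.2), `H₁(A, ℚ) ≅ E` and `V ≅ E^∨ ≅ E` as `E`-modules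
(trace form).  With `V = E`, the vector `a ∈ E = H¹(A, ℚ)` has coordinates `(φ(a))_{φ ∈ S}` in the eigenbasis of
`V_ℂ = E ⊗_ℚ ℂ ≅ ℂ^S`; this map `H¹(A, ℚ) → H¹(A, ℂ) = ℂ^S` is `ratVec`.  It is `E`-equivariant for `E` acting on the
`φ`-th coordinate through `φ` (the "diagonal torus").  This is the paper's rational structure ON THE NOSE, not only up to the
diagonal torus: for `A = ℂ^g/Φ(𝓞_E)` one has `H₁(A, ℚ) = E`, `H¹(A, ℂ) = Hom_ℚ(E, ℂ) = ⊕_{φ ∈ S} ℂφ` (the embeddings `φ` ARE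
degree-one classes — whence the paper's notation `ℂφ`, `[P] = ⋀_{φ ∈ P} φ`), and the vector with coordinates `(φ(a))_φ`, i.e. the
functional `Σ_φ φ(a) φ = Tr_{E/ℚ}(a ·)`, is rational; `a ↦ Tr_{E/ℚ}(a ·)` is an `E`-module isomorphism `E ≅ Hom_ℚ(E, ℚ) = H¹(A, ℚ)`
(trace form of an étale algebra). -/
def ratVec : E →ₗ[ℚ] VC E where
  toFun a := fun φ => φ a
  map_add' a b := by ext φ; simp
  map_smul' q a := by ext φ; simp

/-- (Ported verbatim from the HodgeCMPerL package; no docstring in the source.) -/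
@[simp] theorem ratVec_apply (a : E) (φ : Emb E) : ratVec E a φ = φ a := rfl

/-- (Ported verbatim from the HodgeCMPerL package; no docstring in the source.) -/
theorem ratVec_mul (a b : E) : ratVec E (a * b) = fun φ => φ a * ratVec E b φ := by
  ext φ; simp

variable [Module.Finite ℚ E]

/-- The standard basis vector `φ ∈ ℂ^S` (§3.1 writes the generator of the eigenline `V_{ℂ,φ}` simply as `φ`:
"`H^{1,0}(A, ℂ) = Σ_{φ ∈ Φ} ℂφ`").  (`Hom(E, ℂ)` is finite because `E` is finite-dimensional.) -/
def e (φ : Emb E) : VC E := Pi.basisFun ℂ (Emb E) φ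

/-- `H^r(A, ℂ) = ⋀^r ℂ^S` (§3.1, art. p. 10–11, chunk p0011 L25, verbatim: "We have an isomorphism `H^r(A, ℂ) = ⋀^r ℂ^S`"). -/
abbrev Hr (r : ℕ) : Type := ⋀[ℂ]^r (VC E)

/-- **`[P] := ⋀_{φ ∈ P} φ`** for `P ∈ 𝒫(S)` with `|P| = r` (§3.1, art. p. 11, chunk p0011 L29–L31, verbatim: "Fix an ordering on `S` …
Let `𝒫(S)` be the set of subsets of `S`. For each subset `P ∈ 𝒫(S)`, let `[P] := ⋀_{φ ∈ P} φ`."), the wedge being taken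
in the increasing order of `S`; this is Mathlib's basis `(Pi.basisFun ℂ S).exteriorPower r` of `⋀^r ℂ^S` indexed by
`Set.powersetCard S r = {P ⊆ S finite | |P| = r}`. -/
def wedge [LinearOrder (Emb E)] (r : ℕ) (P : Set.powersetCard (Emb E) r) : Hr E r :=
  (Pi.basisFun ℂ (Emb E)).exteriorPower r P

/-- **The rational structure `H^r(A, ℚ) ⊂ H^r(A, ℂ)`**: `H^r(A, ℚ) = ⋀^r_ℚ H¹(A, ℚ)`, i.e. the `ℚ`-span of the wedges
`v₁ ∧ ⋯ ∧ v_r` of rational vectors `v_i ∈ H¹(A, ℚ) = E` inside `⋀^r_ℂ ℂ^S` (§3.1 uses `H^{2p}(A, ℚ) ⊂ H^{2p}(A, ℂ) = ⋀^{2p} ℂ^S`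
in "`B^p(A) := H^{p,p}(A, ℂ) ∩ H^{2p}(A, ℚ)`"; that the cohomology ring of the complex torus `A` is the exterior algebra
on `H¹` over `ℚ` is the content of "`H^r(A, ℂ) = ⋀^r ℂ^S`" read over `ℚ`). -/
def ratStr (r : ℕ) : Submodule ℚ (Hr E r) :=
  Submodule.span ℚ (Set.range fun a : Fin r → E => exteriorPower.ιMulti ℂ r (fun i => ratVec E (a i)))

variable {E}

/-- **`H^{p,p}(A, ℂ)`** (§3.1, art. p. 11, chunks p0011 L31–p0012 L1, verbatim: "Then the component
`H^{p,q}(A, ℂ) = ⋀^p H^{1,0}(A, ℂ) ⊗ ⋀^q H^{0,1}(A, ℂ)` of the Hodge decomposition has a basis consisting of the `[P]` such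
that `|P ∩ Φ| = p` and `|P ∩ Φ̄| = q` for `P` an ordered subset of `S`", where "`H^{1,0}(A, ℂ) = Σ_{φ ∈ Φ} ℂφ` and
`H^{0,1}(A, ℂ) = Σ_{φ' ∈ Φ̄} ℂφ'`").  Only the piece `p = q` in degree `2p` is needed for `B^p`. -/
def Hpp [LinearOrder (Emb E)] (Φ : CMTypeOn E) (p : ℕ) : Submodule ℂ (Hr E (2 * p)) :=
  Submodule.span ℂ {x | ∃ P : Set.powersetCard (Emb E) (2 * p),
    ((P : Finset (Emb E)) ∩ Φ.Φ).card = p ∧ ((P : Finset (Emb E)) ∩ Φ.bar).card = p ∧ x = wedge E (2 * p) P}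

/-- **`B^p(A) := H^{p,p}(A, ℂ) ∩ H^{2p}(A, ℚ)`**, "the `ℚ`-vector space of `ℚ`-Hodge cycles of type `(p,p)` on `A`"
(§3.1, art. p. 10, chunk p0011 L21, verbatim). -/
def Bp [LinearOrder (Emb E)] (Φ : CMTypeOn E) (p : ℕ) : Submodule ℚ (Hr E (2 * p)) :=
  ratStr E (2 * p) ⊓ (Hpp Φ p).restrictScalars ℚ

/-- **Condition (3.2)** on `P ∈ 𝒫(S)`: "`|σP ∩ Φ| = |σP ∩ Φ̄|` for all `σ ∈ G`" (`G = Gal(E^c/ℚ)` acting on `𝒫(S)`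
through its action on `S = Hom(E, ℂ)`). -/
def SatisfiesEq32 (Φ : CMTypeOn E) (P : Finset (Emb E)) : Prop :=
  ∀ σ : galoisClosure E ≃ₐ[ℚ] galoisClosure E,
    (galActSet E σ P ∩ Φ.Φ).card = (galActSet E σ P ∩ Φ.bar).card

/-- The paper's ordering convention on `S` (§3.1, verbatim: "Fix an ordering on `S` such that `φ ≤ φ'` for each `φ ∈ Φ`
and `φ' ∈ Φ̄`"). -/
def OrderConvention [LinearOrder (Emb E)] (Φ : CMTypeOn E) : Prop :=
  ∀ φ ∈ Φ.Φ, ∀ φ' ∈ Φ.bar, φ ≤ φ'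

end Model

/-! ### Theorem 3.1 (Pohlmann), as printed -/

/-- **Gao–Ullmo, J. Inst. Math. Jussieu 25 (2025) 215–249, Theorem 3.1 "(Pohlmann)"** (§3.1, art. p. 11, chunk p0012 L3–L6, proof L10–L22;
arXiv:2411.12249 §3.1, chunk p0009 L32–L44), VERBATIM: "Let `A` be a CM abelian variety, associated with the CM pair `(E, Φ)`. Let `E^c` be the Galois closure of
`E` … and let `G = Gal(E^c/ℚ)`. […] **Theorem 3.1 (Pohlmann).** For each `p ≥ 0`, the vector space `B^p(A) ⊗ ℂ` has a
basis consisting of `[P]` for those ordered sets `P ∈ 𝒫(S)` with `|P| = 2p` such that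
(3.2) `|σP ∩ Φ| = |σP ∩ Φ̄|` for all `σ ∈ G`."  Proof printed loc. cit. ("Pohlmann [Poh68, Thm. 1] states this result
when `A` is simple. The proof remains valid for an arbitrary CM abelian variety `A`. To make the paper more
self-contained, we include the proof here." — a half-page Galois-descent argument), originally H. Pohlmann, *Algebraic
cycles on abelian varieties of complex multiplication type*, Ann. of Math. (2) **88** (1968) 161–180, Thm 1 (simple `A`).

Typed over the paper's own model of `H^•(A)` (this file, §2.3/§3.1): for every CM algebra `E`, every CM type `Φ` on `E`,
every ordering of `S = Hom(E, ℂ)` obeying the paper's convention, and every `p`, the `ℂ`-span of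
`B^p(A) = H^{2p}(A, ℚ) ∩ H^{p,p}(A, ℂ)` inside `H^{2p}(A, ℂ) = ⋀^{2p} ℂ^S` EQUALS the `ℂ`-span of the vectors `[P]`, `|P| = 2p`,
satisfying (3.2).  (The `[P]` are members of a basis of `⋀^{2p} ℂ^S`, hence linearly independent, so "span = span" is
exactly "the `[P]` with (3.2) form a basis of `B^p(A) ⊗ ℂ`".)  A named `Prop`; KERNEL-PROVED as `GaoUllmo.Theorem31_holds`
(`HodgeCM/Literature/GaoUllmoTheorem31.lean`, gate run 20) — consumers may use that theorem or take `(h : Theorem31)` as a hypothesis. -/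
def Theorem31 : Prop :=
  ∀ (E : Type) [CommRing E] [Algebra ℚ E] [Module.Finite ℚ E] [LinearOrder (Emb E)], IsCMAlgebra E →
    ∀ (Φ : CMTypeOn E), OrderConvention Φ → ∀ p : ℕ,
      Submodule.span ℂ (Bp Φ p : Set (Hr E (2 * p))) =
        Submodule.span ℂ {x | ∃ P : Set.powersetCard (Emb E) (2 * p),
          SatisfiesEq32 Φ (P : Finset (Emb E)) ∧ x = wedge E (2 * p) P}

/-- **Theorem 3.1, "In particular" clause** (art. p. 11, chunk p0012 L8, verbatim): "In particular `dim_ℚ B^p(A)` is the number of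
ordered `P ∈ 𝒫(S)` with `|P| = 2p` satisfying (3.2)."  Same hypotheses as `Theorem31`; KERNEL-PROVED: `GaoUllmo.Theorem31_finrank_holds` (run 21). -/
def Theorem31_finrank : Prop :=
  ∀ (E : Type) [CommRing E] [Algebra ℚ E] [Module.Finite ℚ E] [LinearOrder (Emb E)], IsCMAlgebra E →
    ∀ (Φ : CMTypeOn E), OrderConvention Φ → ∀ p : ℕ,
      Module.finrank ℚ (Bp Φ p) =
        Nat.card {P : Set.powersetCard (Emb E) (2 * p) // SatisfiesEq32 Φ (P : Finset (Emb E))}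

/-! ### §4.2 / Proposition 4.5 / Proposition 5.1: the kernel of the reflex norm on characters (anti-Weyl type) -/

section Kernel

variable (g : ℕ)

/-- The characters of `(E^*)^×` for `E` of Weyl type of degree `2g` (§4.2, art. p. 14, chunk p0017 L3): "`X^*((E^*)^×) = ℤ[Hom(E^*, ℂ)]`"
with `Hom(E^*, ℂ)` identified via `η^*` (eq. (4.5)) with "`{ε_I H'}_{I ⊆ {1,…,g}}`" and "we denote by `ε_I` the basis of
`X^*((E^*)^×)` corresponding to the coset `ε_I H'`": the free `ℤ`-module on the subsets `I ⊆ {1, …, g}`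
(here `{1,…,g}` is `Fin g`). -/
abbrev XStar : Type := Finset (Fin g) →₀ ℤ

/-- The basis vector `ε_I ∈ X^*((E^*)^×)`. -/
def eps (I : Finset (Fin g)) : XStar g := Finsupp.single I 1

/-- The characters of `E^×` (§2.3, art. p. 8, chunk p0008 L9): "`X^*(E^×) = ⊕_{φ ∈ Φ} ℤφ ⊕ ⊕_{φ ∈ Φ} ℤφ̄`", `Φ = {φ₁,…,φ_g}`: the free
`ℤ`-module on the `2g` symbols `φ_j` (coded `(j, false)`) and `φ̄_j` (coded `(j, true)`). -/
abbrev XE : Type := (Fin g × Bool) →₀ ℤ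

/-- `φ_j ∈ X^*(E^×)`. -/
def phi (j : Fin g) : XE g := Finsupp.single (j, false) 1

/-- `φ̄_j ∈ X^*(E^×)`. -/
def phibar (j : Fin g) : XE g := Finsupp.single (j, true) 1

/-- **Proposition 4.5** (§4.2 end, art. p. 15, chunks p0017 L22–p0018 L5, verbatim): "The group homomorphism induced by the reflex norm (2.4) (but with `E`
and `E^*` switched) `rec^* : X^*((E^*)^×) = ℤ[G/H'] ⟶ X^*(E^×) = ℤ[Hom(E, ℂ)]` is given by: for all `I ⊆ {1,…,g}`,
`ε_I H' ↦ Σ_{j ∉ I} φ_j + Σ_{j ∈ I} φ̄_j`."  Taken here as the DEFINITION of `rec^*` on the character lattices (the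
proposition identifies the geometric reflex norm with this formula; only the formula enters Proposition 5.1). -/
def recStar : XStar g →ₗ[ℤ] XE g :=
  Finsupp.linearCombination ℤ fun I : Finset (Fin g) =>
    (∑ j ∈ Finset.univ.filter (fun j => j ∉ I), phi g j) + ∑ j ∈ I, phibar g j

/-- (Ported verbatim from the HodgeCMPerL package; no docstring in the source.) -/
theorem recStar_eps (I : Finset (Fin g)) :
    recStar g (eps g I) = (∑ j ∈ Finset.univ.filter (fun j => j ∉ I), phi g j) + ∑ j ∈ I, phibar g j := by
  simp [recStar, eps]

/-- `N' := ker(rec^*)` (§5, art. p. 15, chunk p0018 L23: "`0 ⟶ N' → X^*((E^*)^×) —rec^*→ X^*(E^×)`"). -/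
def Nprime : Submodule ℤ (XStar g) := LinearMap.ker (recStar g)

/-- `N₁`: "the submodule of `N'` generated by all the `ε_I + ε_J − ε_K − ε_L` with `I ∩ J = K ∩ L` and `I ∪ J = K ∪ L`"
(§5, art. p. 16, chunk p0019 L16, before Lemma 5.5), as a submodule of `X^*((E^*)^×)`. -/
def quadRel : Submodule ℤ (XStar g) :=
  Submodule.span ℤ {x | ∃ I J K L : Finset (Fin g),
    I ∩ J = K ∩ L ∧ I ∪ J = K ∪ L ∧ x = eps g I + eps g J - eps g K - eps g L}

/-- **Gao–Ullmo, Proposition 5.1** (§5, art. p. 15, chunk p0018 L29; proof chunk p0019 L34–L40, verbatim): "The kernel `N'` is generated by all the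
`ε_I + ε_J − ε_K − ε_L` with `I ∩ J = K ∩ L` and `I ∪ J = K ∪ L`."  Here `N' = ker(rec^*)` with `rec^*` given by the formula of
Proposition 4.5, `I, J, K, L ⊆ {1,…,g}`, `g ≥ 1` (§4.1: "`E` a CM field of degree `2g`"; for `g = 0` the statement would be
false: `X^* = ℤε_∅`, `rec^* = 0`); "generated" = equality of `ℤ`-submodules of `X^*((E^*)^×)`.  Cited in the 2001
write-up rfwf v3 (ll. 281–289, 329; `results.tex` l. 139 "(GEN)") for "the face relations generate `R_F ⊗ ℚ`"; NOT used by
the Lean package, which proves its lattice statement `HodgeCM.Prior.AllgGroup.RfwfAllgGroup.gfaces_generate` itself. -/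
def Proposition51 : Prop := ∀ g : ℕ, 0 < g → Nprime g = quadRel g

end Kernel

/-! ### API lemmas (proved): non-vacuity of the hypotheses, linear independence of the `[P]`, the easy half of Prop 5.1 -/

section API

/-- A finite product of CM fields is a CM algebra in the sense of `IsCMAlgebra` (by `AlgEquiv.refl`); in particular the
cell's `E = F^{n+1}` (`F` a CM field) is one. -/
theorem isCMAlgebra_pi (ι : Type) [Fintype ι] (K : Type) [Field K] [NumberField K] [NumberField.IsCMField K] :
    IsCMAlgebra (ι → K) :=
  ⟨ι, inferInstance, fun _ => K, inferInstance, inferInstance, fun _ => inferInstance, ⟨AlgEquiv.refl⟩⟩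

variable {E : Type} [CommRing E] [Algebra ℚ E] [Module.Finite ℚ E]

/-- The paper's ordering convention can always be met: there is a linear order on `S = Hom(E, ℂ)` with `Φ` before `Φ̄`. -/
theorem exists_orderConvention (Φ : CMTypeOn E) :
    ∃ r : LinearOrder (Emb E), @OrderConvention E _ _ r Φ := by
  classical
  obtain ⟨N, ⟨g⟩⟩ := Finite.exists_equiv_fin (Emb E)
  let key : Emb E → Bool ×ₗ Fin N := fun φ => toLex (decide (φ ∉ Φ.Φ), g φ)
  have hkey : Function.Injective key := by
    intro φ ψ h
    have h2 := congrArg (fun x => (ofLex x).2) h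
    exact g.injective (by simpa [key] using h2)
  refine ⟨LinearOrder.lift' key hkey, ?_⟩
  intro φ hφ φ' hφ'
  rw [CMTypeOn.mem_bar_iff] at hφ'
  show key φ ≤ key φ'
  apply le_of_lt
  simp only [key, Prod.Lex.toLex_lt_toLex]
  left
  simp [hφ, hφ']

/-- The vectors `[P]`, `P ∈ 𝒫(S)`, `|P| = r`, are linearly independent in `⋀^r ℂ^S` (they form a basis). -/
theorem linearIndependent_wedge [LinearOrder (Emb E)] (r : ℕ) :
    LinearIndependent ℂ (wedge E r) :=
  ((Pi.basisFun ℂ (Emb E)).exteriorPower r).linearIndependent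

/-- The `[P]` span `⋀^r ℂ^S`. -/
theorem span_wedge_eq_top [LinearOrder (Emb E)] (r : ℕ) :
    Submodule.span ℂ (Set.range (wedge E r)) = ⊤ :=
  ((Pi.basisFun ℂ (Emb E)).exteriorPower r).span_eq


-- port_pkg: scope closed for this part
end API
end GaoUllmo
end HodgeCM
end
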